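import Literature.AlgebraicGeometry.HodgeTheory.RibetTypeOnePowersHodgeClasses
import Literature.AlgebraicGeometry.VanGeemen1994.WeilTypeHodgeGroupSU
import Literature.AlgebraicGeometry.HodgeTheory.HOneOfProductEndomorphismBlocks
import Literature.AlgebraicGeometry.HodgeTheory.AbelianVarietyEndomorphismsHOne
import Literature.AlgebraicGeometry.Motives.AbelianVarietyCohomologyExteriorH1
import HarnessLib

/-!
# The block data of the tied socket at `A = Y₄ × (E_K × E_K)`: colours, eigenspace identification (`hKle`, `hKge`, `hS1`, `hW₀`) and the tie by the factor swap (`hσ`) (TABLE X row 20; Moonen–Zarhin 1999 §2 (2.1), §5; Milne 1999 §1)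

Family `hodge`, layer `Literature/AlgebraicGeometry/HodgeTheory`, namespace `Literature.AlgebraicGeometry.HodgeTheory`.
THEOREMS ONLY: no definition, no named fact, no `sorry` (D-0026). Cell `pub-hodgeav-hg6` (req-37 (A) Q2b), seat eng-2 g8,
brick **E1a** (lead g4 2026-08-29T10:09:06Z GO; E1b = `…BlockDataCentral` carries `hφC`, `hEndU`, `hEndT` and the package).
HONEST FRAMING: HC ∕ HC_AV (stmt-1333) ∕ HC_CM (stmt-3052) ∕ H2 NOT proved and do not occur; this file is Künneth bookkeeping
in degree one on a triple product.

WHAT. The tied socket S3-T (`IsWeilType.mem_hodgeGroupOne_of_mem_unitaryCentralizerGroup_tied_of_hodgeLieC`,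
`WeilTypeTiedBlockedHodgeGroupOfLie`) displays, for a blocking endomorphism `φ_E` with colours `μ`, the member data
`hinj`, `hKle`, `hKge`, `hS1`, `hW₀`, `hσ` (this file) and `hφC`, `hEndU`, `hEndT` (E1b). Here they are DERIVED for every
`A = Y.prod (E.prod E)` with `φ_Y ≫ φ_Y = −d` on `Y`, `χ ≫ χ = −d` on the curve `E` (`dim E = 1`), the diagonal
`Φ` (`Φ ≫ fst = fst ≫ φ_Y`, `Φ ≫ snd = snd ≫ Φ₂`, `Φ₂ ≫ fst = fst ≫ χ`, `Φ₂ ≫ snd = snd ≫ χ`), for the CONSTRUCTED blocking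
endomorphism `φ_E := diag(φ_Y, diag(2χ, 3χ))` (`CMTypeProducts.blockDiag`), the colours `μ k := (k + 1) · i√d` on `Fin 3`,
the tied colours `S = {1, 2}` and the untied colour `k₀ = 0`:
* §0 plumbing: `blockDiag` has the prescribed corners; `(n • f)^* = n • f^*`; no eigenvalue `c` with `c² ≠ −e` for `g ≫ g = −e`;
  transport of eigenspaces along `H¹(−; ℚ) ⊗ ℂ ≅ H¹(−(ℂ); ℂ)`.
* §1 **`CMCurveSqFourfold.mem_eigenspace_blockDiag₃_iff`** — `v` is a `c`-eigenvector of `diag(f, diag(g₁, g₂))^*_ℂ` iff its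
  three Künneth components are `c`-eigenvectors of `f^*_ℂ`, `g₁^*_ℂ`, `g₂^*_ℂ` (`HOneProduct` Künneth in degree one, twice).
* §2 the data: `…_colour_injective` (hinj), `…_eigenspace_le_weil` (hKle), `…_weil_le_iSup_eigenspace` (hKge),
  `…_finrank_eigenspace_tied_eq_one` (hS1: the tied blocks are the two lines `pr₂^*pr_i^* W_K(E)`, `dim W_K(E) = 1` by
  `two_mul_finrank_eigenspace_eq` on the curve), `…_eigenspace_untied_ne_bot` (hW₀: `pr₁^* W_K(Y) ≠ 0`),
  **`…_exists_tie`** (hσ: the swap `diag(𝟙_Y, (pr₂, pr₁))` carries the first `E`-line onto the second and back).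

## References
* [MoonenZarhin1999LowDim] B. Moonen, Yu. Zarhin, Math. Ann. 315 (1999), §2 (2.1), (2.3), §5 (5.2)–(5.3).
* [Milne1999LefschetzClasses] J. S. Milne, Duke Math. J. 96 (1999), §1 pp. 642–644.
* [VoisinHodgeI2002] C. Voisin, Hodge Theory I (2002), §11.3.3 Thm. 11.38 (Künneth).
* [LangeBirkenhake1992] H. Lange, Ch. Birkenhake, Complex Abelian Varieties (1992), §1.1 Prop. 1.1.9.
-/

noncomputable section

open scoped TensorProduct
open CategoryTheory Module

namespace Literature.AlgebraicGeometry.HodgeTheory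

open Literature.AlgebraicTopology.SingularHomology
open Literature.AlgebraicGeometry.Motives (AbelianVariety bettiCohomology ofRatClassBaseChange)
open Literature.AlgebraicGeometry.Motives.AbelianVariety (fst snd prodLift prod_hom_ext prodLift_fst prodLift_snd)
open Literature.AlgebraicGeometry.Milne1999.CMTypeProducts (blockDiag)
open Literature.AlgebraicGeometry.VanGeemen1994 (pullbackOne)
open Literature.AlgebraicGeometry.ComplexMultiplication (bettiCohomology_map_comp_hom bettiCohomology_map_add_one
  bettiCohomology_map_nsmul_one bettiCohomology_map_id_hom)
open HOneProduct

/-! ### §0 Plumbing -/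

section Plumbing

variable {A B : AbelianVariety ℂ}

/-- `diag(f, g) ≫ pr₁ = pr₁ ≫ f`. [cite: Milne1999LefschetzClasses, §1 p. 642] -/
theorem CMCurveSqFourfold.blockDiag_comp_fst (f : A ⟶ A) (g : B ⟶ B) :
    blockDiag A B f g ≫ fst A B = fst A B ≫ f := by
  rw [blockDiag_eq, Preadditive.add_comp, Category.assoc, Category.assoc, Category.assoc, Category.assoc, inlHom_fst,
    inrHom_fst, Category.comp_id, Limits.comp_zero, Limits.comp_zero, add_zero]

/-- `diag(f, g) ≫ pr₂ = pr₂ ≫ g`. [cite: Milne1999LefschetzClasses, §1 p. 642] -/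
theorem CMCurveSqFourfold.blockDiag_comp_snd (f : A ⟶ A) (g : B ⟶ B) :
    blockDiag A B f g ≫ snd A B = snd A B ≫ g := by
  rw [blockDiag_eq, Preadditive.add_comp, Category.assoc, Category.assoc, Category.assoc, Category.assoc, inlHom_snd,
    inrHom_snd, Category.comp_id, Limits.comp_zero, Limits.comp_zero, zero_add]

/-- An endomorphism of `A × B` with diagonal corners `f`, `g` on the projections IS `diag(f, g)`.
[cite: Milne1999LefschetzClasses, §1 p. 642] -/
theorem CMCurveSqFourfold.eq_blockDiag_of_comp {Φ : A.prod B ⟶ A.prod B} {f : A ⟶ A} {g : B ⟶ B}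
    (h₁ : Φ ≫ fst A B = fst A B ≫ f) (h₂ : Φ ≫ snd A B = snd A B ≫ g) : Φ = blockDiag A B f g :=
  prod_hom_ext (by rw [h₁, CMCurveSqFourfold.blockDiag_comp_fst]) (by rw [h₂, CMCurveSqFourfold.blockDiag_comp_snd])

/-- `(n • f)^* = n • f^*` on `H¹(−; ℚ)`, as linear maps. [folklore] -/
private theorem pull_nsmul (n : ℕ) (f : A ⟶ B) :
    (bettiCohomology.map (n • f).hom.hom.hom 1).hom = (n : ℚ) • (bettiCohomology.map f.hom.hom.hom 1).hom := by
  rw [bettiCohomology_map_nsmul_one, ModuleCat.hom_nsmul, Nat.cast_smul_eq_nsmul]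

/-- `(q : ℂ) • z = q • z` on `V_ℂ`. [folklore] -/
private theorem ratCast_smul₈ {V : Type*} [AddCommGroup V] [Module ℚ V] (q : ℚ) (z : ℂ ⊗[ℚ] V) :
    (q : ℂ) • z = q • z := by
  rw [← algebraMap_smul ℂ q z, eq_ratCast]

/-- `(n • f) ≫ (n • f) = −(n²e)` when `f ≫ f = −e`. [folklore] -/
private theorem nsmul_comp_nsmul_eq {f : A ⟶ A} {e : ℕ} (hf : f ≫ f = -(e • 𝟙 A)) (n : ℕ) :
    (n • f) ≫ (n • f) = -((n * n * e) • 𝟙 A) := by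
  rw [Preadditive.nsmul_comp, Preadditive.comp_nsmul, hf, smul_neg, smul_neg, smul_smul, smul_smul]

/-- **No eigenvalue `c` with `c² ≠ −e` for `g^*_ℂ` when `g ≫ g = −e`.** [cite: MoonenZarhin1999LowDim, §2 (2.1)] -/
theorem CMCurveSqFourfold.eigenspace_eq_bot_of_sq_ne {g : A ⟶ A} {e : ℕ} (hg : g ≫ g = -(e • 𝟙 A)) {c : ℂ}
    (hc : c * c ≠ -(e : ℂ)) :
    Module.End.eigenspace (((bettiCohomology.map g.hom.hom.hom 1).hom).baseChange ℂ) c = ⊥ := by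
  rw [Submodule.eq_bot_iff]
  intro x hx
  rw [Module.End.mem_eigenspace_iff] at hx
  have h2 := bettiMapHom_mul_self hg
  have h3 : ((bettiCohomology.map g.hom.hom.hom 1).hom).baseChange ℂ
      ((((bettiCohomology.map g.hom.hom.hom 1).hom).baseChange ℂ) x) = (-(e : ℂ)) • x := by
    rw [← Module.End.mul_apply, ← LinearMap.baseChange_mul, h2, LinearMap.baseChange_neg, LinearMap.baseChange_smul,
      LinearMap.neg_apply, LinearMap.smul_apply, LinearMap.baseChange_one, Module.End.one_apply, neg_smul,
      ← algebraMap_smul ℂ (e : ℚ) x, eq_ratCast, Rat.cast_natCast]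
  rw [hx, map_smul, hx, smul_smul] at h3
  have h4 : (c * c - -(e : ℂ)) • x = 0 := by rw [sub_smul, h3, sub_self]
  exact (smul_eq_zero.1 h4).resolve_left (sub_ne_zero.2 hc)

/-- `(n • g)^*_ℂ x = (n c) x ↔ g^*_ℂ x = c x` (`n ≠ 0`). [folklore] -/
private theorem mem_eigenspace_nsmul_iff {g : A ⟶ A} {n : ℕ} (hn : n ≠ 0) (c : ℂ)
    (x : ℂ ⊗[ℚ] bettiCohomology A.X 1) :
    x ∈ Module.End.eigenspace (((bettiCohomology.map (n • g).hom.hom.hom 1).hom).baseChange ℂ) ((n : ℂ) * c) ↔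
      x ∈ Module.End.eigenspace (((bettiCohomology.map g.hom.hom.hom 1).hom).baseChange ℂ) c := by
  rw [Module.End.mem_eigenspace_iff, Module.End.mem_eigenspace_iff, pull_nsmul, LinearMap.baseChange_smul,
    LinearMap.smul_apply, ← ratCast_smul₈, Rat.cast_natCast, mul_smul]
  exact (smul_right_injective _ (Nat.cast_ne_zero.2 hn)).eq_iff

/-- **Transport of eigenspaces along `ρ : H¹(A; ℚ) ⊗ ℂ ≅ H¹(A(ℂ); ℂ)`**: `ρ(W_c(φ^*_ℂ)) = W_c(φ^*)`.
[cite: vanGeemen1994HodgeAV, 4.9] -/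
theorem CMCurveSqFourfold.map_eigenspace_baseChange_eq (φ : A ⟶ A) (c : ℂ) :
    Submodule.map ((ofRatClassBaseChangeEquiv (AbelianVariety.isSmoothProjective_holds (A := A)) 1 :
        ℂ ⊗[ℚ] bettiCohomology A.X 1 ≃ₗ[ℂ] complexBetti A.X 1) : ℂ ⊗[ℚ] bettiCohomology A.X 1 →ₗ[ℂ] complexBetti A.X 1)
      (Module.End.eigenspace (((bettiCohomology.map φ.hom.hom.hom 1).hom).baseChange ℂ) c) =
      Module.End.eigenspace (pullbackOne A φ) c := by
  set ρ := ofRatClassBaseChangeEquiv (AbelianVariety.isSmoothProjective_holds (A := A)) 1 with hρ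
  have hρφ : ∀ z, ρ (((bettiCohomology.map φ.hom.hom.hom 1).hom).baseChange ℂ z) = pullbackOne A φ (ρ z) := fun z => by
    rw [hρ, ofRatClassBaseChangeEquiv_apply, ofRatClassBaseChangeEquiv_apply, ofRatClassBaseChange_baseChange_bettiMapHom]
  ext y
  constructor
  · rintro ⟨z, hz, rfl⟩
    rw [SetLike.mem_coe, Module.End.mem_eigenspace_iff] at hz
    rw [Module.End.mem_eigenspace_iff, LinearEquiv.coe_coe, ← hρφ, hz, map_smul]
  · intro hy
    refine ⟨ρ.symm y, ?_, by simp⟩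
    rw [SetLike.mem_coe, Module.End.mem_eigenspace_iff]
    apply ρ.injective
    rw [hρφ, LinearEquiv.apply_symm_apply, map_smul, LinearEquiv.apply_symm_apply]
    exact Module.End.mem_eigenspace_iff.1 hy

/-- `dim_ℂ W_{i√d}(φ^*_ℂ) = dim A` for `φ ≫ φ = −d` on `H¹(A; ℚ) ⊗ ℂ` (`2 · dim W = b₁ = 2 dim A`).
[cite: LangeBirkenhake1992, §1.1 Prop. 1.1.9 (p. 20)] [cite: vanGeemen1994HodgeAV, 4.9] -/
theorem CMCurveSqFourfold.finrank_eigenspace_baseChange_eq_dim {φ : A ⟶ A} {d : ℕ} (hd : 0 < d)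
    (hφ : φ ≫ φ = -(d • 𝟙 A)) :
    Module.finrank ℂ ↥(Module.End.eigenspace (((bettiCohomology.map φ.hom.hom.hom 1).hom).baseChange ℂ)
      (Complex.I * (Real.sqrt d : ℂ))) = A.dim := by
  set ρ := ofRatClassBaseChangeEquiv (AbelianVariety.isSmoothProjective_holds (A := A)) 1 with hρ
  have h1 := (ρ.submoduleMap (Module.End.eigenspace (((bettiCohomology.map φ.hom.hom.hom 1).hom).baseChange ℂ)
    (Complex.I * (Real.sqrt d : ℂ)))).finrank_eq
  have h2 := CMCurveSqFourfold.map_eigenspace_baseChange_eq φ (Complex.I * (Real.sqrt d : ℂ))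
  have h3 := two_mul_finrank_eigenspace_eq hd hφ
  rw [Motives.AbelianVariety.finrank_complexBetti_one] at h3
  have h4 : Module.finrank ℂ ↥(Module.End.eigenspace (pullbackOne A φ) (Complex.I * (Real.sqrt d : ℂ))) = A.dim :=
    Nat.eq_of_mul_eq_mul_left two_pos h3
  rw [h1, ← h4, ← h2]

end Plumbing

/-! ### §1 Eigenvectors of `diag(f, diag(g₁, g₂))^*_ℂ` on `H¹(Y × (E × E)) ⊗ ℂ` -/

section Triple

variable {Y E : AbelianVariety ℂ}

/-- The pull-back of `diag(f, diag(g₁, g₂))` in the three Künneth components.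
[cite: VoisinHodgeI2002, §11.3.3 Thm. 11.38] -/
theorem CMCurveSqFourfold.pull_blockDiag₃_baseChange_apply (f : Y ⟶ Y) (g₁ g₂ : E ⟶ E)
    (v : ℂ ⊗[ℚ] bettiCohomology (Y.prod (E.prod E)).X 1) :
    ((bettiCohomology.map (blockDiag Y (E.prod E) f (blockDiag E E g₁ g₂)).hom.hom.hom 1).hom).baseChange ℂ v =
      (pullFst Y (E.prod E)).baseChange ℂ ((((bettiCohomology.map f.hom.hom.hom 1).hom).baseChange ℂ)
        ((pullInl Y (E.prod E)).baseChange ℂ v)) +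
      (pullSnd Y (E.prod E)).baseChange ℂ ((pullFst E E).baseChange ℂ
        ((((bettiCohomology.map g₁.hom.hom.hom 1).hom).baseChange ℂ)
          ((pullInl E E).baseChange ℂ ((pullInr Y (E.prod E)).baseChange ℂ v)))) +
      (pullSnd Y (E.prod E)).baseChange ℂ ((pullSnd E E).baseChange ℂ
        ((((bettiCohomology.map g₂.hom.hom.hom 1).hom).baseChange ℂ)
          ((pullInr E E).baseChange ℂ ((pullInr Y (E.prod E)).baseChange ℂ v)))) := by
  have h1 : (bettiCohomology.map (blockDiag Y (E.prod E) f (blockDiag E E g₁ g₂)).hom.hom.hom 1).hom =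
      pullFst Y (E.prod E) ∘ₗ (bettiCohomology.map f.hom.hom.hom 1).hom ∘ₗ pullInl Y (E.prod E) +
        pullSnd Y (E.prod E) ∘ₗ (pullFst E E ∘ₗ (bettiCohomology.map g₁.hom.hom.hom 1).hom ∘ₗ pullInl E E +
          pullSnd E E ∘ₗ (bettiCohomology.map g₂.hom.hom.hom 1).hom ∘ₗ pullInr E E) ∘ₗ pullInr Y (E.prod E) := by
    have h := pull_blockDiag (A := Y) (B := E.prod E) f (blockDiag E E g₁ g₂)
    rw [pull_blockDiag (A := E) (B := E) g₁ g₂] at h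
    exact h
  rw [h1]
  simp only [LinearMap.baseChange_add, LinearMap.baseChange_comp, LinearMap.add_apply, LinearMap.comp_apply, map_add,
    add_assoc]

/-- **The three Künneth components detect eigenvectors**: `v ∈ H¹(Y × (E × E)) ⊗ ℂ` is a `c`-eigenvector of
`diag(f, diag(g₁, g₂))^*_ℂ` iff `ι_Y^* v`, `ι₁^* ι_P^* v`, `ι₂^* ι_P^* v` are `c`-eigenvectors of `f^*_ℂ`, `g₁^*_ℂ`, `g₂^*_ℂ`.
[cite: VoisinHodgeI2002, §11.3.3 Thm. 11.38] [cite: MoonenZarhin1999LowDim, §5 (5.2)] -/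
theorem CMCurveSqFourfold.mem_eigenspace_blockDiag₃_iff (f : Y ⟶ Y) (g₁ g₂ : E ⟶ E) (c : ℂ)
    (v : ℂ ⊗[ℚ] bettiCohomology (Y.prod (E.prod E)).X 1) :
    v ∈ Module.End.eigenspace (((bettiCohomology.map (blockDiag Y (E.prod E) f
        (blockDiag E E g₁ g₂)).hom.hom.hom 1).hom).baseChange ℂ) c ↔
      (pullInl Y (E.prod E)).baseChange ℂ v ∈
          Module.End.eigenspace (((bettiCohomology.map f.hom.hom.hom 1).hom).baseChange ℂ) c ∧
        (pullInl E E).baseChange ℂ ((pullInr Y (E.prod E)).baseChange ℂ v) ∈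
          Module.End.eigenspace (((bettiCohomology.map g₁.hom.hom.hom 1).hom).baseChange ℂ) c ∧
        (pullInr E E).baseChange ℂ ((pullInr Y (E.prod E)).baseChange ℂ v) ∈
          Module.End.eigenspace (((bettiCohomology.map g₂.hom.hom.hom 1).hom).baseChange ℂ) c := by
  simp only [Module.End.mem_eigenspace_iff]
  constructor
  · intro hv
    rw [CMCurveSqFourfold.pull_blockDiag₃_baseChange_apply] at hv
    have hY := congrArg ((pullInl Y (E.prod E)).baseChange ℂ) hv
    have h1 := congrArg (fun w => (pullInl E E).baseChange ℂ ((pullInr Y (E.prod E)).baseChange ℂ w)) hv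
    have h2 := congrArg (fun w => (pullInr E E).baseChange ℂ ((pullInr Y (E.prod E)).baseChange ℂ w)) hv
    simp only [map_add, map_smul, pullInl_pullFst_baseChange, pullInl_pullSnd_baseChange, pullInr_pullSnd_baseChange,
      pullInr_pullFst_baseChange, add_zero, zero_add] at hY h1 h2
    exact ⟨hY, h1, h2⟩
  · rintro ⟨hY, h1, h2⟩
    have hv : v = (pullFst Y (E.prod E)).baseChange ℂ ((pullInl Y (E.prod E)).baseChange ℂ v) +
        ((pullSnd Y (E.prod E)).baseChange ℂ ((pullFst E E).baseChange ℂ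
          ((pullInl E E).baseChange ℂ ((pullInr Y (E.prod E)).baseChange ℂ v))) +
        (pullSnd Y (E.prod E)).baseChange ℂ ((pullSnd E E).baseChange ℂ
          ((pullInr E E).baseChange ℂ ((pullInr Y (E.prod E)).baseChange ℂ v)))) := by
      rw [← map_add, pullFst_pullInl_add_baseChange, pullFst_pullInl_add_baseChange]
    conv_lhs => rw [CMCurveSqFourfold.pull_blockDiag₃_baseChange_apply, hY, h1, h2]
    conv_rhs => rw [hv]
    simp only [map_smul, smul_add, add_assoc]

end Triple

/-! ### §2 The block data at `A = Y × (E × E)`: colours `(k+1)·i√d`, blocking endomorphism `diag(φ_Y, diag(2χ, 3χ))`, tied colours `{1, 2}` -/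

section BlockData

variable {Y E : AbelianVariety ℂ} {d : ℕ}

/-- **hinj**: the colours `μ k = (k + 1) · i√d` (`k : Fin 3`) are pairwise distinct (`d > 0`). [cite: MoonenZarhin1999LowDim, §2 (2.1)] -/
theorem CMCurveSqFourfold.colour_injective (hd : 0 < d) :
    Function.Injective (fun k : Fin 3 => ((k : ℕ) + 1 : ℂ) * (Complex.I * (Real.sqrt d : ℂ))) := by
  intro k k' h
  have hμ0 : Complex.I * (Real.sqrt d : ℂ) ≠ 0 := mul_ne_zero Complex.I_ne_zero
    (Complex.ofReal_ne_zero.2 (Real.sqrt_ne_zero'.2 (Nat.cast_pos.2 hd)))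
  have h1 := mul_right_cancel₀ hμ0 h
  have h2 : ((k : ℕ) : ℂ) = ((k' : ℕ) : ℂ) := add_right_cancel h1
  exact Fin.ext (by exact_mod_cast h2)

/-- Squares of the colours: `((k+1)·i√d)² = −(k+1)² d`. [folklore] -/
private theorem colour_sq (d : ℕ) (m : ℕ) :
    ((m : ℂ) * (Complex.I * (Real.sqrt d : ℂ))) * ((m : ℂ) * (Complex.I * (Real.sqrt d : ℂ))) = -((m * m * d : ℕ) : ℂ) := by
  have hI : Complex.I * (Real.sqrt d : ℂ) * (Complex.I * (Real.sqrt d : ℂ)) = -(d : ℂ) := by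
    rw [mul_mul_mul_comm, Complex.I_mul_I, ← Complex.ofReal_mul, Real.mul_self_sqrt (Nat.cast_nonneg d),
      Complex.ofReal_natCast, neg_one_mul]
  rw [mul_mul_mul_comm, hI]
  push_cast
  ring

/-- Distinct multiples have distinct squares: `(m i√d)² ≠ −(m′² d)` for `m ≠ m′` (`d > 0`). [folklore] -/
private theorem colour_sq_ne (hd : 0 < d) {m m' : ℕ} (hmm : m ≠ m') :
    ((m : ℂ) * (Complex.I * (Real.sqrt d : ℂ))) * ((m : ℂ) * (Complex.I * (Real.sqrt d : ℂ))) ≠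
      -((m' * m' * d : ℕ) : ℂ) := by
  rw [colour_sq]
  intro h
  have h1 : ((m * m * d : ℕ) : ℂ) = ((m' * m' * d : ℕ) : ℂ) := neg_injective h
  have h2 : m * m * d = m' * m' * d := by exact_mod_cast h1
  have h3 : m * m = m' * m' := Nat.eq_of_mul_eq_mul_right hd h2
  exact hmm (Nat.mul_self_inj.1 h3)

variable (φY : Y ⟶ Y) (χ : E ⟶ E)

/-- The eigenspaces of the blocking endomorphism `φ_E = diag(φ_Y, diag(2χ, 3χ))` at the colour `(m+1) i√d`, `m < 3`,
in Künneth components: exactly one component survives (`φ_Y ≫ φ_Y = −d`, `χ ≫ χ = −d`).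
[cite: MoonenZarhin1999LowDim, §2 (2.1) and §5 (5.2)] -/
theorem CMCurveSqFourfold.mem_eigenspace_colour_iff (hd : 0 < d) (hφY : φY ≫ φY = -(d • 𝟙 Y))
    (hχ : χ ≫ χ = -(d • 𝟙 E)) (k : Fin 3) (v : ℂ ⊗[ℚ] bettiCohomology (Y.prod (E.prod E)).X 1) :
    v ∈ Module.End.eigenspace (((bettiCohomology.map (blockDiag Y (E.prod E) φY
        (blockDiag E E (2 • χ) (3 • χ))).hom.hom.hom 1).hom).baseChange ℂ)
        (((k : ℕ) + 1 : ℂ) * (Complex.I * (Real.sqrt d : ℂ))) ↔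
      ((k = 0 ∧ (pullInl Y (E.prod E)).baseChange ℂ v ∈ Module.End.eigenspace
          (((bettiCohomology.map φY.hom.hom.hom 1).hom).baseChange ℂ) (Complex.I * (Real.sqrt d : ℂ))) ∨
        (k ≠ 0 ∧ (pullInl Y (E.prod E)).baseChange ℂ v = 0)) ∧
      ((k = 1 ∧ (pullInl E E).baseChange ℂ ((pullInr Y (E.prod E)).baseChange ℂ v) ∈ Module.End.eigenspace
          (((bettiCohomology.map χ.hom.hom.hom 1).hom).baseChange ℂ) (Complex.I * (Real.sqrt d : ℂ))) ∨
        (k ≠ 1 ∧ (pullInl E E).baseChange ℂ ((pullInr Y (E.prod E)).baseChange ℂ v) = 0)) ∧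
      ((k = 2 ∧ (pullInr E E).baseChange ℂ ((pullInr Y (E.prod E)).baseChange ℂ v) ∈ Module.End.eigenspace
          (((bettiCohomology.map χ.hom.hom.hom 1).hom).baseChange ℂ) (Complex.I * (Real.sqrt d : ℂ))) ∨
        (k ≠ 2 ∧ (pullInr E E).baseChange ℂ ((pullInr Y (E.prod E)).baseChange ℂ v) = 0)) := by
  have h2χ : (2 • χ) ≫ (2 • χ) = -((2 * 2 * d) • 𝟙 E) := nsmul_comp_nsmul_eq hχ 2
  have h3χ : (3 • χ) ≫ (3 • χ) = -((3 * 3 * d) • 𝟙 E) := nsmul_comp_nsmul_eq hχ 3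
  have h1Y : φY ≫ φY = -((1 * 1 * d) • 𝟙 Y) := by rw [one_mul, one_mul]; exact hφY
  rw [CMCurveSqFourfold.mem_eigenspace_blockDiag₃_iff]
  have hcast : ∀ m : ℕ, ((m : ℕ) : ℂ) * (Complex.I * (Real.sqrt d : ℂ)) = ((m : ℕ) : ℂ) * (Complex.I * (Real.sqrt d : ℂ)) :=
    fun _ => rfl
  have hk1 : ((k : ℕ) + 1 : ℂ) = (((k : ℕ) + 1 : ℕ) : ℂ) := by push_cast; ring
  refine and_congr ?_ (and_congr ?_ ?_)
  · -- the `Y`-component: eigenvalue `(k+1) i√d` of `φ_Y^*` exists only for `k = 0`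
    by_cases hk : k = 0
    · subst hk
      simp only [Fin.val_zero, Nat.cast_zero, zero_add, one_mul, true_and, ne_eq, not_true_eq_false, false_and,
        or_false]
    · have hne : (k : ℕ) + 1 ≠ 1 := fun h => hk (Fin.ext (by simpa using h))
      rw [hk1, CMCurveSqFourfold.eigenspace_eq_bot_of_sq_ne h1Y (colour_sq_ne hd hne), Submodule.mem_bot]
      simp [hk]
  · by_cases hk : k = 1
    · subst hk
      have h : ((((1 : Fin 3) : ℕ) + 1 : ℂ)) * (Complex.I * (Real.sqrt d : ℂ)) =
          ((2 : ℕ) : ℂ) * (Complex.I * (Real.sqrt d : ℂ)) := by norm_num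
      rw [h, mem_eigenspace_nsmul_iff two_ne_zero]
      simp
    · have hne : (k : ℕ) + 1 ≠ 2 := fun h => hk (Fin.ext (by simpa using h))
      rw [hk1, CMCurveSqFourfold.eigenspace_eq_bot_of_sq_ne h2χ (colour_sq_ne hd hne), Submodule.mem_bot]
      simp [hk]
  · by_cases hk : k = 2
    · subst hk
      have h : ((((2 : Fin 3) : ℕ) + 1 : ℂ)) * (Complex.I * (Real.sqrt d : ℂ)) =
          ((3 : ℕ) : ℂ) * (Complex.I * (Real.sqrt d : ℂ)) := by norm_num
      rw [h, mem_eigenspace_nsmul_iff three_ne_zero]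
      simp
    · have hne : (k : ℕ) + 1 ≠ 3 := fun h => hk (Fin.ext (by simpa using h))
      rw [hk1, CMCurveSqFourfold.eigenspace_eq_bot_of_sq_ne h3χ (colour_sq_ne hd hne), Submodule.mem_bot]
      simp [hk]


variable {φY χ}

/-- The diagonal `K`-action `Φ` of the consumer (`Φ ≫ pr₁ = pr₁ ≫ φ_Y`, `Φ ≫ pr₂ = pr₂ ≫ Φ₂`, `Φ₂ ≫ prᵢ = prᵢ ≫ χ`) IS
`diag(φ_Y, diag(χ, χ))`. [cite: Milne1999LefschetzClasses, §1 p. 642] -/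
theorem CMCurveSqFourfold.eq_blockDiag₃ {Φ₂ : E.prod E ⟶ E.prod E} (hΦ₂a : Φ₂ ≫ fst E E = fst E E ≫ χ)
    (hΦ₂b : Φ₂ ≫ snd E E = snd E E ≫ χ) {Φ : Y.prod (E.prod E) ⟶ Y.prod (E.prod E)}
    (hΦ₁ : Φ ≫ fst Y (E.prod E) = fst Y (E.prod E) ≫ φY) (hΦ₂ : Φ ≫ snd Y (E.prod E) = snd Y (E.prod E) ≫ Φ₂) :
    Φ = blockDiag Y (E.prod E) φY (blockDiag E E χ χ) := by
  rw [← CMCurveSqFourfold.eq_blockDiag_of_comp hΦ₂a hΦ₂b]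
  exact CMCurveSqFourfold.eq_blockDiag_of_comp hΦ₁ hΦ₂

/-- **The Weil space `W_K(Φ)` in Künneth components**: `v ∈ W_K(Φ)` iff `ι_Y^* v ∈ W_K(Y)`, `ι₁^*ι_P^* v ∈ W_K(E)` and
`ι₂^*ι_P^* v ∈ W_K(E)`. [cite: MoonenZarhin1999LowDim, §5 (5.2)] [cite: VoisinHodgeI2002, §11.3.3 Thm. 11.38] -/
theorem CMCurveSqFourfold.mem_weil_iff {Φ₂ : E.prod E ⟶ E.prod E} (hΦ₂a : Φ₂ ≫ fst E E = fst E E ≫ χ)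
    (hΦ₂b : Φ₂ ≫ snd E E = snd E E ≫ χ) {Φ : Y.prod (E.prod E) ⟶ Y.prod (E.prod E)}
    (hΦ₁ : Φ ≫ fst Y (E.prod E) = fst Y (E.prod E) ≫ φY) (hΦ₂ : Φ ≫ snd Y (E.prod E) = snd Y (E.prod E) ≫ Φ₂)
    (v : ℂ ⊗[ℚ] bettiCohomology (Y.prod (E.prod E)).X 1) :
    v ∈ Module.End.eigenspace (((bettiCohomology.map Φ.hom.hom.hom 1).hom).baseChange ℂ) (Complex.I * (Real.sqrt d : ℂ)) ↔
      (pullInl Y (E.prod E)).baseChange ℂ v ∈ Module.End.eigenspace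
          (((bettiCohomology.map φY.hom.hom.hom 1).hom).baseChange ℂ) (Complex.I * (Real.sqrt d : ℂ)) ∧
        (pullInl E E).baseChange ℂ ((pullInr Y (E.prod E)).baseChange ℂ v) ∈ Module.End.eigenspace
          (((bettiCohomology.map χ.hom.hom.hom 1).hom).baseChange ℂ) (Complex.I * (Real.sqrt d : ℂ)) ∧
        (pullInr E E).baseChange ℂ ((pullInr Y (E.prod E)).baseChange ℂ v) ∈ Module.End.eigenspace
          (((bettiCohomology.map χ.hom.hom.hom 1).hom).baseChange ℂ) (Complex.I * (Real.sqrt d : ℂ)) := by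
  rw [CMCurveSqFourfold.eq_blockDiag₃ hΦ₂a hΦ₂b hΦ₁ hΦ₂]
  exact CMCurveSqFourfold.mem_eigenspace_blockDiag₃_iff φY χ χ _ v

/-- Membership in the untied colour block `W_{i√d}(φ_E)` from the Künneth components. [cite: MoonenZarhin1999LowDim, §5 (5.2)] -/
theorem CMCurveSqFourfold.mem_eigenspace_colour₀ (hd : 0 < d) (hφY : φY ≫ φY = -(d • 𝟙 Y)) (hχ : χ ≫ χ = -(d • 𝟙 E))
    {v : ℂ ⊗[ℚ] bettiCohomology (Y.prod (E.prod E)).X 1}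
    (hY : (pullInl Y (E.prod E)).baseChange ℂ v ∈ Module.End.eigenspace
      (((bettiCohomology.map φY.hom.hom.hom 1).hom).baseChange ℂ) (Complex.I * (Real.sqrt d : ℂ)))
    (h1 : (pullInl E E).baseChange ℂ ((pullInr Y (E.prod E)).baseChange ℂ v) = 0)
    (h2 : (pullInr E E).baseChange ℂ ((pullInr Y (E.prod E)).baseChange ℂ v) = 0) :
    v ∈ Module.End.eigenspace (((bettiCohomology.map (blockDiag Y (E.prod E) φY
        (blockDiag E E (2 • χ) (3 • χ))).hom.hom.hom 1).hom).baseChange ℂ)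
        ((((0 : Fin 3) : ℕ) + 1 : ℂ) * (Complex.I * (Real.sqrt d : ℂ))) :=
  (CMCurveSqFourfold.mem_eigenspace_colour_iff φY χ hd hφY hχ 0 v).2
    ⟨Or.inl ⟨rfl, hY⟩, Or.inr ⟨by decide, h1⟩, Or.inr ⟨by decide, h2⟩⟩

/-- Membership in the first tied colour block `W_{2i√d}(φ_E)` from the Künneth components. [cite: MoonenZarhin1999LowDim, §5 (5.2)] -/
theorem CMCurveSqFourfold.mem_eigenspace_colour₁ (hd : 0 < d) (hφY : φY ≫ φY = -(d • 𝟙 Y)) (hχ : χ ≫ χ = -(d • 𝟙 E))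
    {v : ℂ ⊗[ℚ] bettiCohomology (Y.prod (E.prod E)).X 1} (hY : (pullInl Y (E.prod E)).baseChange ℂ v = 0)
    (h1 : (pullInl E E).baseChange ℂ ((pullInr Y (E.prod E)).baseChange ℂ v) ∈ Module.End.eigenspace
      (((bettiCohomology.map χ.hom.hom.hom 1).hom).baseChange ℂ) (Complex.I * (Real.sqrt d : ℂ)))
    (h2 : (pullInr E E).baseChange ℂ ((pullInr Y (E.prod E)).baseChange ℂ v) = 0) :
    v ∈ Module.End.eigenspace (((bettiCohomology.map (blockDiag Y (E.prod E) φY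
        (blockDiag E E (2 • χ) (3 • χ))).hom.hom.hom 1).hom).baseChange ℂ)
        ((((1 : Fin 3) : ℕ) + 1 : ℂ) * (Complex.I * (Real.sqrt d : ℂ))) :=
  (CMCurveSqFourfold.mem_eigenspace_colour_iff φY χ hd hφY hχ 1 v).2
    ⟨Or.inr ⟨by decide, hY⟩, Or.inl ⟨rfl, h1⟩, Or.inr ⟨by decide, h2⟩⟩

/-- Membership in the second tied colour block `W_{3i√d}(φ_E)` from the Künneth components. [cite: MoonenZarhin1999LowDim, §5 (5.2)] -/
theorem CMCurveSqFourfold.mem_eigenspace_colour₂ (hd : 0 < d) (hφY : φY ≫ φY = -(d • 𝟙 Y)) (hχ : χ ≫ χ = -(d • 𝟙 E))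
    {v : ℂ ⊗[ℚ] bettiCohomology (Y.prod (E.prod E)).X 1} (hY : (pullInl Y (E.prod E)).baseChange ℂ v = 0)
    (h1 : (pullInl E E).baseChange ℂ ((pullInr Y (E.prod E)).baseChange ℂ v) = 0)
    (h2 : (pullInr E E).baseChange ℂ ((pullInr Y (E.prod E)).baseChange ℂ v) ∈ Module.End.eigenspace
      (((bettiCohomology.map χ.hom.hom.hom 1).hom).baseChange ℂ) (Complex.I * (Real.sqrt d : ℂ))) :
    v ∈ Module.End.eigenspace (((bettiCohomology.map (blockDiag Y (E.prod E) φY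
        (blockDiag E E (2 • χ) (3 • χ))).hom.hom.hom 1).hom).baseChange ℂ)
        ((((2 : Fin 3) : ℕ) + 1 : ℂ) * (Complex.I * (Real.sqrt d : ℂ))) :=
  (CMCurveSqFourfold.mem_eigenspace_colour_iff φY χ hd hφY hχ 2 v).2
    ⟨Or.inr ⟨by decide, hY⟩, Or.inr ⟨by decide, h1⟩, Or.inl ⟨rfl, h2⟩⟩

/-- **hKle**: every colour block `W_{μ k}(φ_E)` lies in the Weil space `W_K(Φ)`. [cite: MoonenZarhin1999LowDim, §5 (5.2)] -/
theorem CMCurveSqFourfold.eigenspace_le_weil (hd : 0 < d) (hφY : φY ≫ φY = -(d • 𝟙 Y)) (hχ : χ ≫ χ = -(d • 𝟙 E))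
    {Φ₂ : E.prod E ⟶ E.prod E} (hΦ₂a : Φ₂ ≫ fst E E = fst E E ≫ χ) (hΦ₂b : Φ₂ ≫ snd E E = snd E E ≫ χ)
    {Φ : Y.prod (E.prod E) ⟶ Y.prod (E.prod E)} (hΦ₁ : Φ ≫ fst Y (E.prod E) = fst Y (E.prod E) ≫ φY)
    (hΦ₂ : Φ ≫ snd Y (E.prod E) = snd Y (E.prod E) ≫ Φ₂) (k : Fin 3) :
    Module.End.eigenspace (((bettiCohomology.map (blockDiag Y (E.prod E) φY
        (blockDiag E E (2 • χ) (3 • χ))).hom.hom.hom 1).hom).baseChange ℂ) (((k : ℕ) + 1 : ℂ) * (Complex.I * (Real.sqrt d : ℂ))) ≤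
      Module.End.eigenspace (((bettiCohomology.map Φ.hom.hom.hom 1).hom).baseChange ℂ) (Complex.I * (Real.sqrt d : ℂ)) := by
  intro v hv
  rw [CMCurveSqFourfold.mem_eigenspace_colour_iff φY χ hd hφY hχ k v] at hv
  rw [CMCurveSqFourfold.mem_weil_iff hΦ₂a hΦ₂b hΦ₁ hΦ₂]
  obtain ⟨hY, h1, h2⟩ := hv
  refine ⟨?_, ?_, ?_⟩
  · rcases hY with ⟨-, h⟩ | ⟨-, h⟩
    · exact h
    · rw [h]; exact Submodule.zero_mem _
  · rcases h1 with ⟨-, h⟩ | ⟨-, h⟩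
    · exact h
    · rw [h]; exact Submodule.zero_mem _
  · rcases h2 with ⟨-, h⟩ | ⟨-, h⟩
    · exact h
    · rw [h]; exact Submodule.zero_mem _

/-- **hKge**: the Weil space `W_K(Φ)` is the sum of the three colour blocks (Künneth splitting of a Weil vector).
[cite: MoonenZarhin1999LowDim, §5 (5.2)] [cite: VoisinHodgeI2002, §11.3.3 Thm. 11.38] -/
theorem CMCurveSqFourfold.weil_le_iSup_eigenspace (hd : 0 < d) (hφY : φY ≫ φY = -(d • 𝟙 Y)) (hχ : χ ≫ χ = -(d • 𝟙 E))
    {Φ₂ : E.prod E ⟶ E.prod E} (hΦ₂a : Φ₂ ≫ fst E E = fst E E ≫ χ) (hΦ₂b : Φ₂ ≫ snd E E = snd E E ≫ χ)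
    {Φ : Y.prod (E.prod E) ⟶ Y.prod (E.prod E)} (hΦ₁ : Φ ≫ fst Y (E.prod E) = fst Y (E.prod E) ≫ φY)
    (hΦ₂ : Φ ≫ snd Y (E.prod E) = snd Y (E.prod E) ≫ Φ₂) :
    Module.End.eigenspace (((bettiCohomology.map Φ.hom.hom.hom 1).hom).baseChange ℂ) (Complex.I * (Real.sqrt d : ℂ)) ≤
      ⨆ k : Fin 3, Module.End.eigenspace (((bettiCohomology.map (blockDiag Y (E.prod E) φY
        (blockDiag E E (2 • χ) (3 • χ))).hom.hom.hom 1).hom).baseChange ℂ) (((k : ℕ) + 1 : ℂ) * (Complex.I * (Real.sqrt d : ℂ))) := by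
  intro v hv
  rw [CMCurveSqFourfold.mem_weil_iff hΦ₂a hΦ₂b hΦ₁ hΦ₂] at hv
  obtain ⟨hY, h1, h2⟩ := hv
  set a := (pullInl Y (E.prod E)).baseChange ℂ v with ha
  set b := (pullInl E E).baseChange ℂ ((pullInr Y (E.prod E)).baseChange ℂ v) with hb
  set c := (pullInr E E).baseChange ℂ ((pullInr Y (E.prod E)).baseChange ℂ v) with hc
  have hsplit : v = (pullFst Y (E.prod E)).baseChange ℂ a +
      ((pullSnd Y (E.prod E)).baseChange ℂ ((pullFst E E).baseChange ℂ b) +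
        (pullSnd Y (E.prod E)).baseChange ℂ ((pullSnd E E).baseChange ℂ c)) := by
    rw [ha, hb, hc, ← map_add, pullFst_pullInl_add_baseChange, pullFst_pullInl_add_baseChange]
  rw [hsplit]
  refine Submodule.add_mem _ (Submodule.mem_iSup_of_mem 0 ?_)
    (Submodule.add_mem _ (Submodule.mem_iSup_of_mem 1 ?_) (Submodule.mem_iSup_of_mem 2 ?_))
  · refine CMCurveSqFourfold.mem_eigenspace_colour₀ hd hφY hχ ?_ ?_ ?_
    · rw [pullInl_pullFst_baseChange]; exact hY
    · rw [pullInr_pullFst_baseChange, map_zero]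
    · rw [pullInr_pullFst_baseChange, map_zero]
  · refine CMCurveSqFourfold.mem_eigenspace_colour₁ hd hφY hχ ?_ ?_ ?_
    · rw [pullInl_pullSnd_baseChange]
    · rw [pullInr_pullSnd_baseChange, pullInl_pullFst_baseChange]; exact h1
    · rw [pullInr_pullSnd_baseChange, pullInr_pullFst_baseChange]
  · refine CMCurveSqFourfold.mem_eigenspace_colour₂ hd hφY hχ ?_ ?_ ?_
    · rw [pullInl_pullSnd_baseChange]
    · rw [pullInr_pullSnd_baseChange, pullInl_pullSnd_baseChange]
    · rw [pullInr_pullSnd_baseChange, pullInr_pullSnd_baseChange]; exact h2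

/-- The first tied colour block is the line `pr₂^* pr₁^* W_K(E)`. [cite: MoonenZarhin1999LowDim, §5 (5.2)] -/
theorem CMCurveSqFourfold.eigenspace_tied₁_eq_map (hd : 0 < d) (hφY : φY ≫ φY = -(d • 𝟙 Y)) (hχ : χ ≫ χ = -(d • 𝟙 E)) :
    Module.End.eigenspace (((bettiCohomology.map (blockDiag Y (E.prod E) φY
        (blockDiag E E (2 • χ) (3 • χ))).hom.hom.hom 1).hom).baseChange ℂ)
        ((((1 : Fin 3) : ℕ) + 1 : ℂ) * (Complex.I * (Real.sqrt d : ℂ))) =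
      Submodule.map (((pullSnd Y (E.prod E)).baseChange ℂ) ∘ₗ ((pullFst E E).baseChange ℂ))
        (Module.End.eigenspace (((bettiCohomology.map χ.hom.hom.hom 1).hom).baseChange ℂ) (Complex.I * (Real.sqrt d : ℂ))) := by
  ext v
  rw [Submodule.mem_map]
  constructor
  · intro hv
    obtain ⟨hY, h1, h2⟩ := (CMCurveSqFourfold.mem_eigenspace_colour_iff φY χ hd hφY hχ 1 v).1 hv
    replace hY : (pullInl Y (E.prod E)).baseChange ℂ v = 0 := by
      rcases hY with ⟨h, -⟩ | ⟨-, h⟩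
      · exact absurd h (by decide)
      · exact h
    replace h1 : (pullInl E E).baseChange ℂ ((pullInr Y (E.prod E)).baseChange ℂ v) ∈ Module.End.eigenspace
        (((bettiCohomology.map χ.hom.hom.hom 1).hom).baseChange ℂ) (Complex.I * (Real.sqrt d : ℂ)) := by
      rcases h1 with ⟨-, h⟩ | ⟨h, -⟩
      · exact h
      · exact absurd rfl h
    replace h2 : (pullInr E E).baseChange ℂ ((pullInr Y (E.prod E)).baseChange ℂ v) = 0 := by
      rcases h2 with ⟨h, -⟩ | ⟨-, h⟩
      · exact absurd h (by decide)
      · exact h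
    refine ⟨_, h1, ?_⟩
    have h := pullFst_pullInl_add_baseChange (A := Y) (B := E.prod E) v
    rw [hY, map_zero, zero_add, ← pullFst_pullInl_add_baseChange (A := E) (B := E)
      ((pullInr Y (E.prod E)).baseChange ℂ v), h2, map_zero, add_zero] at h
    rw [LinearMap.comp_apply]
    exact h
  · rintro ⟨w, hw, rfl⟩
    rw [LinearMap.comp_apply]
    refine CMCurveSqFourfold.mem_eigenspace_colour₁ hd hφY hχ ?_ ?_ ?_
    · rw [pullInl_pullSnd_baseChange]
    · rw [pullInr_pullSnd_baseChange, pullInl_pullFst_baseChange]; exact hw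
    · rw [pullInr_pullSnd_baseChange, pullInr_pullFst_baseChange]

/-- The second tied colour block is the line `pr₂^* pr₂^* W_K(E)`. [cite: MoonenZarhin1999LowDim, §5 (5.2)] -/
theorem CMCurveSqFourfold.eigenspace_tied₂_eq_map (hd : 0 < d) (hφY : φY ≫ φY = -(d • 𝟙 Y)) (hχ : χ ≫ χ = -(d • 𝟙 E)) :
    Module.End.eigenspace (((bettiCohomology.map (blockDiag Y (E.prod E) φY
        (blockDiag E E (2 • χ) (3 • χ))).hom.hom.hom 1).hom).baseChange ℂ)
        ((((2 : Fin 3) : ℕ) + 1 : ℂ) * (Complex.I * (Real.sqrt d : ℂ))) =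
      Submodule.map (((pullSnd Y (E.prod E)).baseChange ℂ) ∘ₗ ((pullSnd E E).baseChange ℂ))
        (Module.End.eigenspace (((bettiCohomology.map χ.hom.hom.hom 1).hom).baseChange ℂ) (Complex.I * (Real.sqrt d : ℂ))) := by
  ext v
  rw [Submodule.mem_map]
  constructor
  · intro hv
    obtain ⟨hY, h1, h2⟩ := (CMCurveSqFourfold.mem_eigenspace_colour_iff φY χ hd hφY hχ 2 v).1 hv
    replace hY : (pullInl Y (E.prod E)).baseChange ℂ v = 0 := by
      rcases hY with ⟨h, -⟩ | ⟨-, h⟩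
      · exact absurd h (by decide)
      · exact h
    replace h1 : (pullInl E E).baseChange ℂ ((pullInr Y (E.prod E)).baseChange ℂ v) = 0 := by
      rcases h1 with ⟨h, -⟩ | ⟨-, h⟩
      · exact absurd h (by decide)
      · exact h
    replace h2 : (pullInr E E).baseChange ℂ ((pullInr Y (E.prod E)).baseChange ℂ v) ∈ Module.End.eigenspace
        (((bettiCohomology.map χ.hom.hom.hom 1).hom).baseChange ℂ) (Complex.I * (Real.sqrt d : ℂ)) := by
      rcases h2 with ⟨-, h⟩ | ⟨h, -⟩
      · exact h
      · exact absurd rfl h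
    refine ⟨_, h2, ?_⟩
    have h := pullFst_pullInl_add_baseChange (A := Y) (B := E.prod E) v
    rw [hY, map_zero, zero_add, ← pullFst_pullInl_add_baseChange (A := E) (B := E)
      ((pullInr Y (E.prod E)).baseChange ℂ v), h1, map_zero, zero_add] at h
    rw [LinearMap.comp_apply]
    exact h
  · rintro ⟨w, hw, rfl⟩
    rw [LinearMap.comp_apply]
    refine CMCurveSqFourfold.mem_eigenspace_colour₂ hd hφY hχ ?_ ?_ ?_
    · rw [pullInl_pullSnd_baseChange]
    · rw [pullInr_pullSnd_baseChange, pullInl_pullSnd_baseChange]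
    · rw [pullInr_pullSnd_baseChange, pullInr_pullSnd_baseChange]; exact hw

/-- **hS1**: the tied colour blocks are LINES (`dim W_K(E) = dim E = 1`). [cite: MoonenZarhin1999LowDim, §2 (2.1) and §5 (5.2)]
[cite: LangeBirkenhake1992, §1.1 Prop. 1.1.9 (p. 20)] -/
theorem CMCurveSqFourfold.finrank_eigenspace_tied_eq_one (hd : 0 < d) (hφY : φY ≫ φY = -(d • 𝟙 Y))
    (hE1 : E.dim = 1) (hχ : χ ≫ χ = -(d • 𝟙 E)) :
    ∀ k ∈ ({1, 2} : Finset (Fin 3)), Module.finrank ℂ ↥(Module.End.eigenspace (((bettiCohomology.map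
      (blockDiag Y (E.prod E) φY (blockDiag E E (2 • χ) (3 • χ))).hom.hom.hom 1).hom).baseChange ℂ)
        (((k : ℕ) + 1 : ℂ) * (Complex.I * (Real.sqrt d : ℂ)))) = 1 := by
  intro k hk
  have hfin := CMCurveSqFourfold.finrank_eigenspace_baseChange_eq_dim hd hχ
  rw [hE1] at hfin
  rw [Finset.mem_insert, Finset.mem_singleton] at hk
  rcases hk with rfl | rfl
  · have hinj : Function.Injective (((pullSnd Y (E.prod E)).baseChange ℂ) ∘ₗ ((pullFst E E).baseChange ℂ)) := by
      rw [LinearMap.coe_comp]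
      exact pullSnd_baseChange_injective.comp pullFst_baseChange_injective
    rw [CMCurveSqFourfold.eigenspace_tied₁_eq_map hd hφY hχ, ← (Submodule.equivMapOfInjective _ hinj _).finrank_eq,
      hfin]
  · have hinj : Function.Injective (((pullSnd Y (E.prod E)).baseChange ℂ) ∘ₗ ((pullSnd E E).baseChange ℂ)) := by
      rw [LinearMap.coe_comp]
      exact pullSnd_baseChange_injective.comp pullSnd_baseChange_injective
    rw [CMCurveSqFourfold.eigenspace_tied₂_eq_map hd hφY hχ, ← (Submodule.equivMapOfInjective _ hinj _).finrank_eq,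
      hfin]

/-- **hW₀**: the untied colour block `W_{i√d}(φ_E) ⊇ pr₁^* W_K(Y)` is non-zero (`dim W_K(Y) = dim Y > 0`).
[cite: MoonenZarhin1999LowDim, §5 (5.2)] [cite: LangeBirkenhake1992, §1.1 Prop. 1.1.9 (p. 20)] -/
theorem CMCurveSqFourfold.eigenspace_untied_ne_bot (hd : 0 < d) (h0Y : 0 < Y.dim) (hφY : φY ≫ φY = -(d • 𝟙 Y))
    (hχ : χ ≫ χ = -(d • 𝟙 E)) :
    Module.End.eigenspace (((bettiCohomology.map (blockDiag Y (E.prod E) φY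
        (blockDiag E E (2 • χ) (3 • χ))).hom.hom.hom 1).hom).baseChange ℂ)
        ((((0 : Fin 3) : ℕ) + 1 : ℂ) * (Complex.I * (Real.sqrt d : ℂ))) ≠ ⊥ := by
  have hfin := CMCurveSqFourfold.finrank_eigenspace_baseChange_eq_dim hd hφY
  have hne : Module.End.eigenspace (((bettiCohomology.map φY.hom.hom.hom 1).hom).baseChange ℂ)
      (Complex.I * (Real.sqrt d : ℂ)) ≠ ⊥ := by
    intro h
    rw [h, finrank_bot] at hfin
    omega
  obtain ⟨w, hw, hw0⟩ := (Submodule.ne_bot_iff _).1 hne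
  rw [Submodule.ne_bot_iff]
  refine ⟨(pullFst Y (E.prod E)).baseChange ℂ w, ?_, fun h => hw0 (pullFst_baseChange_injective (by rw [h, map_zero]))⟩
  refine CMCurveSqFourfold.mem_eigenspace_colour₀ hd hφY hχ ?_ ?_ ?_
  · rw [pullInl_pullFst_baseChange]; exact hw
  · rw [pullInr_pullFst_baseChange, map_zero]
  · rw [pullInr_pullFst_baseChange, map_zero]

/-- The pull-back along the factor swap `diag(𝟙_Y, (pr₂, pr₁))` exchanges the two `E`-letters of `H¹(Y × (E × E)) ⊗ ℂ`.
[cite: Milne1999LefschetzClasses, §1 p. 644] [cite: VoisinHodgeI2002, §11.3.3 Thm. 11.38] -/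
theorem CMCurveSqFourfold.pull_swap_baseChange_apply (u u' : ℂ ⊗[ℚ] bettiCohomology E.X 1) :
    ((bettiCohomology.map (blockDiag Y (E.prod E) (𝟙 Y) (prodLift (snd E E) (fst E E))).hom.hom.hom 1).hom).baseChange ℂ
        ((pullSnd Y (E.prod E)).baseChange ℂ ((pullFst E E).baseChange ℂ u + (pullSnd E E).baseChange ℂ u')) =
      (pullSnd Y (E.prod E)).baseChange ℂ ((pullSnd E E).baseChange ℂ u + (pullFst E E).baseChange ℂ u') := by
  have hσ₁ : BettiUniverse.pull (prodLift (snd E E) (fst E E)).hom.hom.hom 1 ∘ₗ pullFst E E = pullSnd E E := by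
    change (bettiCohomology.map _ 1).hom ∘ₗ (bettiCohomology.map _ 1).hom = (bettiCohomology.map _ 1).hom
    rw [← ModuleCat.hom_comp, ← bettiCohomology_map_comp_hom, prodLift_fst]
  have hσ₂ : BettiUniverse.pull (prodLift (snd E E) (fst E E)).hom.hom.hom 1 ∘ₗ pullSnd E E = pullFst E E := by
    change (bettiCohomology.map _ 1).hom ∘ₗ (bettiCohomology.map _ 1).hom = (bettiCohomology.map _ 1).hom
    rw [← ModuleCat.hom_comp, ← bettiCohomology_map_comp_hom, prodLift_snd]
  have h := pull_blockDiag (A := Y) (B := E.prod E) (𝟙 Y) (prodLift (snd E E) (fst E E))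
  change ((bettiCohomology.map _ 1).hom) = _ at h
  have hc : ∀ z, (BettiUniverse.pull (prodLift (snd E E) (fst E E)).hom.hom.hom 1).baseChange ℂ
      ((pullFst E E).baseChange ℂ z) = (pullSnd E E).baseChange ℂ z := fun z => by
    have e := LinearMap.congr_fun (congrArg (LinearMap.baseChange ℂ) hσ₁) z
    rwa [LinearMap.baseChange_comp, LinearMap.comp_apply] at e
  have hc' : ∀ z, (BettiUniverse.pull (prodLift (snd E E) (fst E E)).hom.hom.hom 1).baseChange ℂ
      ((pullSnd E E).baseChange ℂ z) = (pullFst E E).baseChange ℂ z := fun z => by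
    have e := LinearMap.congr_fun (congrArg (LinearMap.baseChange ℂ) hσ₂) z
    rwa [LinearMap.baseChange_comp, LinearMap.comp_apply] at e
  rw [h]
  simp only [LinearMap.baseChange_add, LinearMap.baseChange_comp, LinearMap.add_apply, LinearMap.comp_apply]
  rw [pullInl_pullSnd_baseChange, map_zero, map_zero, zero_add, pullInr_pullSnd_baseChange, map_add, hc, hc', add_comm]

/-- **hσ — THE TIE**: for any two tied colours `k, k' ∈ {1, 2}` some endomorphism of `Y × (E × E)` (the identity, or the
swap `diag(𝟙_Y, (pr₂, pr₁))` of the two `E`-factors) carries a vector of `W_{μ k}` to a non-zero vector of `W_{μ k'}`.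
[cite: MoonenZarhin1999LowDim, §5 (5.2)–(5.3)] [cite: Milne1999LefschetzClasses, §1 p. 644] -/
theorem CMCurveSqFourfold.exists_tie (hd : 0 < d) (hφY : φY ≫ φY = -(d • 𝟙 Y)) (hE1 : E.dim = 1)
    (hχ : χ ≫ χ = -(d • 𝟙 E)) :
    ∀ k ∈ ({1, 2} : Finset (Fin 3)), ∀ k' ∈ ({1, 2} : Finset (Fin 3)),
      ∃ (θ : Y.prod (E.prod E) ⟶ Y.prod (E.prod E)) (x : ℂ ⊗[ℚ] bettiCohomology (Y.prod (E.prod E)).X 1),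
        x ∈ Module.End.eigenspace (((bettiCohomology.map (blockDiag Y (E.prod E) φY
          (blockDiag E E (2 • χ) (3 • χ))).hom.hom.hom 1).hom).baseChange ℂ) (((k : ℕ) + 1 : ℂ) * (Complex.I * (Real.sqrt d : ℂ))) ∧
        ((bettiCohomology.map θ.hom.hom.hom 1).hom).baseChange ℂ x ≠ 0 ∧
        ((bettiCohomology.map θ.hom.hom.hom 1).hom).baseChange ℂ x ∈ Module.End.eigenspace (((bettiCohomology.map
          (blockDiag Y (E.prod E) φY (blockDiag E E (2 • χ) (3 • χ))).hom.hom.hom 1).hom).baseChange ℂ)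
            (((k' : ℕ) + 1 : ℂ) * (Complex.I * (Real.sqrt d : ℂ))) := by
  -- a non-zero vector of `W_K(E)`
  have hfin := CMCurveSqFourfold.finrank_eigenspace_baseChange_eq_dim hd hχ
  rw [hE1] at hfin
  have hne : Module.End.eigenspace (((bettiCohomology.map χ.hom.hom.hom 1).hom).baseChange ℂ)
      (Complex.I * (Real.sqrt d : ℂ)) ≠ ⊥ := by
    intro h
    rw [h, finrank_bot] at hfin
    exact zero_ne_one hfin
  obtain ⟨w, hw, hw0⟩ := (Submodule.ne_bot_iff _).1 hne
  -- the two tied letters `x₁ = pr₂^*pr₁^* w`, `x₂ = pr₂^*pr₂^* w`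
  have hx₁mem : (pullSnd Y (E.prod E)).baseChange ℂ ((pullFst E E).baseChange ℂ w) ∈ Module.End.eigenspace
      (((bettiCohomology.map (blockDiag Y (E.prod E) φY (blockDiag E E (2 • χ) (3 • χ))).hom.hom.hom 1).hom).baseChange ℂ)
        ((((1 : Fin 3) : ℕ) + 1 : ℂ) * (Complex.I * (Real.sqrt d : ℂ))) := by
    refine CMCurveSqFourfold.mem_eigenspace_colour₁ hd hφY hχ ?_ ?_ ?_
    · rw [pullInl_pullSnd_baseChange]
    · rw [pullInr_pullSnd_baseChange, pullInl_pullFst_baseChange]; exact hw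
    · rw [pullInr_pullSnd_baseChange, pullInr_pullFst_baseChange]
  have hx₂mem : (pullSnd Y (E.prod E)).baseChange ℂ ((pullSnd E E).baseChange ℂ w) ∈ Module.End.eigenspace
      (((bettiCohomology.map (blockDiag Y (E.prod E) φY (blockDiag E E (2 • χ) (3 • χ))).hom.hom.hom 1).hom).baseChange ℂ)
        ((((2 : Fin 3) : ℕ) + 1 : ℂ) * (Complex.I * (Real.sqrt d : ℂ))) := by
    refine CMCurveSqFourfold.mem_eigenspace_colour₂ hd hφY hχ ?_ ?_ ?_
    · rw [pullInl_pullSnd_baseChange]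
    · rw [pullInr_pullSnd_baseChange, pullInl_pullSnd_baseChange]
    · rw [pullInr_pullSnd_baseChange, pullInr_pullSnd_baseChange]; exact hw
  have hx₁0 : (pullSnd Y (E.prod E)).baseChange ℂ ((pullFst E E).baseChange ℂ w) ≠ 0 := fun h =>
    hw0 (pullFst_baseChange_injective (pullSnd_baseChange_injective (by rw [h, map_zero, map_zero])))
  have hx₂0 : (pullSnd Y (E.prod E)).baseChange ℂ ((pullSnd E E).baseChange ℂ w) ≠ 0 := fun h =>
    hw0 (pullSnd_baseChange_injective (pullSnd_baseChange_injective (by rw [h, map_zero, map_zero])))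
  -- the identity and the swap on the two letters
  have hid : ∀ x : ℂ ⊗[ℚ] bettiCohomology (Y.prod (E.prod E)).X 1,
      ((bettiCohomology.map (𝟙 (Y.prod (E.prod E)) : Y.prod (E.prod E) ⟶ Y.prod (E.prod E)).hom.hom.hom 1).hom).baseChange ℂ
        x = x := fun x => by
    rw [bettiCohomology_map_id_hom, ModuleCat.hom_id, LinearMap.baseChange_id, LinearMap.id_apply]
  have hsw₁ := CMCurveSqFourfold.pull_swap_baseChange_apply (Y := Y) w 0
  have hsw₂ := CMCurveSqFourfold.pull_swap_baseChange_apply (Y := Y) 0 w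
  simp only [map_zero, add_zero, zero_add] at hsw₁ hsw₂
  intro k hk k' hk'
  rw [Finset.mem_insert, Finset.mem_singleton] at hk hk'
  rcases hk with rfl | rfl <;> rcases hk' with rfl | rfl
  · exact ⟨𝟙 _, _, hx₁mem, by rw [hid]; exact hx₁0, by rw [hid]; exact hx₁mem⟩
  · exact ⟨_, _, hx₁mem, by rw [hsw₁]; exact hx₂0, by rw [hsw₁]; exact hx₂mem⟩
  · exact ⟨_, _, hx₂mem, by rw [hsw₂]; exact hx₁0, by rw [hsw₂]; exact hx₁mem⟩
  · exact ⟨𝟙 _, _, hx₂mem, by rw [hid]; exact hx₂0, by rw [hid]; exact hx₂mem⟩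

end BlockData

end Literature.AlgebraicGeometry.HodgeTheory

end
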